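import Summits.QuantumFields.BalabanUV.T4Continuum.Support.NE7ConvOneStepWeightedUnique
import Summits.QuantumFields.BalabanUV.T4Continuum.Support.NE7ConvOneStepCriticalUnique
import HarnessLib

/-!
# NE7ConvOneStepWeightedCriticalUnique — AT MOST ONE CRITICAL ORBIT IN THE WEIGHTED TANGENT CURRENCY: two configurations that are each
# TANGENT-CRITICAL, one represented over the other with F9's weighted letters at the base and ONE ℓ¹-curl letter at the far end, coincide
# (the critical-point half of [Balaban1985Variational] Prop. 7 — F7's `vary_eq_self_of_two_critical` — in F26's k-UNIFORM currency)

Cell `pub-balaban`, rung (B)+1 sub-cell t4, lineage `b2b-balaban-t4-ne7-p1` (CRUX PROVER NE7 #1 = OWNER of row NE7), generation 87; memo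
`t4/b2b-balaban-t4-ne7-p1-g87/ROAD-B-IS-UNIQUENESS.md` §1.  File F233 (over F26 `NE7ConvOneStepWeightedUnique`, F7 `NE7ConvOneStepCriticalUnique`).

WHY.  Road (B)'s END of record (F232 `NE7ApeCurvedRepRoadBClassRowsEnd`, gens 78–86) compares a tangent-critical `U` with a TANGENT-CRITICAL reference `W`
on the same fibre (`hcritW`, `hTopUW`) and displays three Green's-function rows ([B9] Thm 3.3 ∕ (3.49) SHAPE).  But two tangent-critical configurations on one
fibre, one represented over the other, COINCIDE modulo gauge by strict convexity along the segment with a slop at BOTH ends — F7 proved this in the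
`dirSq` currency, whose normal letters are NOT met k-uniformly (memo H11 §1: `θ = O(η²)` needed, `θ ≈ c²ε²∕36` supplied).  THIS FILE is F7 in F9 ∕ F26's
WEIGHTED currency `‖X‖_w² = curlSq + (L^k)^{−2}dirSq`, where the letters ARE met k-uniformly by row NE3's smooth right inverse (F30 `repW_of_routePi`);
the far end needs only the ℓ¹-curl letter of its normal part (no `ν`: the Poincaré letter lives at the base).
WHAT ([folklore]; 0 def, 0 sorry).
§1 **`energyNormW_sq_eq_zero_of_two_slops`** — F26's `energyNormW_sq_eq_zero_of_slop` with the action comparison `A(Ue^X) ≤ A(U)` REPLACED by a far-end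
   slop `dAction (Ue^X) X ≤ κ′·‖X‖_w²` and the line `κ + κ′ < c_X` (the full slope integral `φ′(1) − φ′(0) ≥ c_X‖X‖_w²`, F7's `dirSq_eq_zero_of_two_slops`
   at `D := ‖X‖_w²`); **`vary_eq_self_of_two_slops_weighted`** ⟹ `X = 0`, `Ue^X = U`.
§2 **`vary_eq_self_of_two_critical_weighted`** — slice-generic: `U` unitary, `SmallField U a`, critical on a Poincaré slice `T` (`SlicePoincare L k U T C`,
   `C ≥ 0`); `X` skew `M`-periodic, `‖X‖_∞ ≤ α`, `SmallField (Ue^X) a`; base split `X = X_T + X_N` (`X_T ∈ T`, `‖X_N‖_w ≤ ν‖X‖_w`, `a·Σ‖curl_U X_N‖ ≤ κ₁‖X‖_w²`);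
   the far configuration `Ue^X` critical on a set `T′` ∋ the tangent part of a far split `X = X′_T + X′_N` with `a·Σ‖curl_{Ue^X} X′_N‖ ≤ κ′₁‖X‖_w²`;
   line `κ₁ + κ′₁ < ((m∕2 − 576d(e^α−1)²(L^k)²)∕card n − 28d(a+7α²)(L^k)²)`, `m = (1∕2 − ν²)∕(2(1+C)) − ν²` ⟹ `X = 0 ∧ Ue^X = U`.
§3 **`vary_eq_self_of_tanCritical_pair_repW`** — class level (F26 §2's twin): `U♯ ∈ admissible (sfClass d L N ε) L (k+1) V` TANGENT-CRITICAL, (P♮)_W on the class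
   (constant `CP`), `X` with F9's letters at `U♯` (`X_T ∈ T_♮(U♯)`), `SmallField (U♯e^X) (ε(L^{k+1})^{−2})`, `U♯e^X` TANGENT-CRITICAL with a far split whose tangent
   part is a `U♯e^X`-tangent skew periodic field ⟹ `X = 0 ∧ U♯e^X = U♯`.
§4 **`gaugeAct_eq_of_tanCritical_pair`**, **`smallField_of_tanCritical_pair_repW_gauge`** — with the gauge identity `U′^u = U♯e^X`: `U′^u = U♯` and
   `SmallField U♯ r ⟹ SmallField U′ r` — «the curved (APE) at a TANGENT-CRITICAL reference» needs NO Green's-function row.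
HONEST FRAMING (page 1): convexity bookkeeping over HYPOTHESES (the representation with its letters at both ends, tangent criticality of both configurations,
(P♮)); nothing is asserted about Bałaban's minimisers; NOT the a-priori estimate WITH GAIN (hape of F31), NOT ONE-STEP, NOT NE7; spine 0∕9; finite T⁴ rung
(B)+1 — NOT infinite volume, NOT mass gap, NOT `BetaPertH`, NOT Clay.  Continuum YM on T⁴ ⇐ BetaPertH ∧ nine spine estimates (0/9 proved); BetaPertH ⇐ (D1) ∧
(D4) ∧ CAP+tail; G-an2-4 gates asym, D1 and NE2/3/4.
-/

set_option autoImplicit false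

open scoped BigOperators Matrix.Norms.L2Operator
open NormedSpace Finset Set

namespace Summit.QuantumFields.BalabanUV.T4Continuum.NE7ConvOneStepWeightedCriticalUnique

open Literature.MathematicalPhysics.QuantumFieldTheory.Balaban1983to89
open B7Prop1Explicit B7Prop2Explicit MatrixLog UnitaryModel
open T4AveragingDeficitWall (IsUnitaryCfg IsSkewDir SmallField fineAction vary curl curlSq dirSq vary_zero_dir)
open T4AveragingDeficitWallBoundary (IsPeriodicCfg periodBox)
open AveragingDeficitPeriodicCounting (IsPeriodicDir)
open AveragingDeficitKDatum (gaugeAct_inv_gaugeAct)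
open AveragingDeficitMultiLevelPrep (TangentIter)
open AveragingDeficitMultiLevelBridge (tower_eq)
open MinimalActionLevels (perWin)
open MinimalActionSandwich (admissible)
open MinimalActionRate (sfClass)
open NE3HessForm (hess dAction)
open NE3HessShapes (plaqsOf)
open NE3SlicePoincareShape (SlicePoincare)
open NE3FrameFreeSliceW (frameFreeBlockLandauW)
open NE3EnergyWeightedShapes (energyNormW energyNormW_nonneg)
open NE3EnergyShapes (IsUnitarySite)
open NE7SegmentPlaquetteRadius (smallField_vary_segment_class)
open NE7OneStepLetters (dAction_ge_of_tangent_critical)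
open NE7ConvOneStepWeighted (curlSq_ge_weighted hess_vary_ge_weighted)
open NE7ConvOneStepWeightedUnique (eq_zero_of_energyNormW_sq_eq_zero smallField_of_gaugeAct_eq)
open NE7ConvOneStepCriticalUnique (abs_dAction_le_of_tangent_critical dirSq_eq_zero_of_two_slops)
open NE7EtaMinimiserGaugeCovariance (isUnitarySite_inv)
open BlockAverageCurrent (smallField_gaugeAct)

noncomputable section

variable {d : ℕ} {n : Type*} [Fintype n] [DecidableEq n]

/-! ## §1 Strict convexity in the weighted currency with a slop at both ends -/

/-- **`‖X‖_w² = 0` FROM TWO SLOPS UNDER THE STRICT WEIGHTED LINE.**  `L ≥ 1`, unitary `U`, skew `M`-periodic `X` (`M ≥ 1`) with `‖X(b)‖ ≤ α` (`α ≥ 0`),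
weighted Poincaré letter `m·‖X‖_w² ≤ curlSq U X`, radius `a′ ≥ 0` of `U e^{tX}` on `[0,1]`, base slop `−κ·‖X‖_w² ≤ dAction U X`, FAR slop
`dAction (Ue^X) X ≤ κ′·‖X‖_w²` (both on `plaqsOf (periodBox M)`) and the STRICT line `κ + κ′ < (m∕2 − 576d(e^α − 1)²(L^k)²)∕card n − 28d·a′·(L^k)²` ⟹
`energyNormW L k U X (periodBox M)² = 0`.  (The slope inequality `φ′(1) − φ′(0) ≥ c_X‖X‖_w²` replaces F26's `φ(1) ≤ φ(0)`.) [folklore] -/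
theorem energyNormW_sq_eq_zero_of_two_slops [Nonempty n] {L k M : ℕ} (hL : 1 ≤ L) (hM : 1 ≤ M) {U : Site d → Fin d → (Matrix n n ℂ)ˣ}
    (hU : IsUnitaryCfg U) {X : Site d → Fin d → Matrix n n ℂ} (hX : IsSkewDir X) (hXP : IsPeriodicDir X M) {α m a' κ κ' : ℝ} (hα : 0 ≤ α)
    (hXα : ∀ x μ, ‖X x μ‖ ≤ α) (hm : m * energyNormW L k U X (periodBox (d := d) M) ^ 2 ≤ curlSq U X (periodBox (d := d) M))
    (ha' : 0 ≤ a') (hrad : ∀ t ∈ Icc (0 : ℝ) 1, SmallField (vary U X t) a')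
    (hleft : -(κ * energyNormW L k U X (periodBox (d := d) M) ^ 2) ≤ dAction U X (plaqsOf (periodBox (d := d) M)))
    (hright : dAction (vary U X 1) X (plaqsOf (periodBox (d := d) M)) ≤ κ' * energyNormW L k U X (periodBox (d := d) M) ^ 2)
    (hline : κ + κ' < (m / 2 - 576 * d * (Real.exp α - 1) ^ 2 * ((L : ℝ) ^ k) ^ 2) / (Fintype.card n : ℝ) - 28 * d * a' * ((L : ℝ) ^ k) ^ 2) :
    energyNormW L k U X (periodBox (d := d) M) ^ 2 = 0 := by
  set E := energyNormW L k U X (periodBox (d := d) M) ^ 2 with hE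
  have hE0 : 0 ≤ E := by rw [hE]; exact sq_nonneg _
  have hconv : ∀ t ∈ Icc (0 : ℝ) 1,
      ((m / 2 - 576 * d * (Real.exp α - 1) ^ 2 * ((L : ℝ) ^ k) ^ 2) / (Fintype.card n : ℝ) - 28 * d * a' * ((L : ℝ) ^ k) ^ 2) * E
        ≤ hess (vary U X t) X X (plaqsOf (periodBox (d := d) M)) :=
    fun t ht => hess_vary_ge_weighted hL hM hU hX hXP hα hXα hm ht ha' (hrad t ht)
  exact dirSq_eq_zero_of_two_slops U X (plaqsOf (periodBox (d := d) M)) hE0 hconv hleft hright hline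

/-- **HENCE THE DIRECTION VANISHES**: under the hypotheses of `energyNormW_sq_eq_zero_of_two_slops`, `X = 0` and `U e^{X} = U`. [folklore] -/
theorem vary_eq_self_of_two_slops_weighted [Nonempty n] {L k M : ℕ} (hL : 1 ≤ L) (hM : 1 ≤ M) {U : Site d → Fin d → (Matrix n n ℂ)ˣ}
    (hU : IsUnitaryCfg U) {X : Site d → Fin d → Matrix n n ℂ} (hX : IsSkewDir X) (hXP : IsPeriodicDir X M) {α m a' κ κ' : ℝ} (hα : 0 ≤ α)
    (hXα : ∀ x μ, ‖X x μ‖ ≤ α) (hm : m * energyNormW L k U X (periodBox (d := d) M) ^ 2 ≤ curlSq U X (periodBox (d := d) M))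
    (ha' : 0 ≤ a') (hrad : ∀ t ∈ Icc (0 : ℝ) 1, SmallField (vary U X t) a')
    (hleft : -(κ * energyNormW L k U X (periodBox (d := d) M) ^ 2) ≤ dAction U X (plaqsOf (periodBox (d := d) M)))
    (hright : dAction (vary U X 1) X (plaqsOf (periodBox (d := d) M)) ≤ κ' * energyNormW L k U X (periodBox (d := d) M) ^ 2)
    (hline : κ + κ' < (m / 2 - 576 * d * (Real.exp α - 1) ^ 2 * ((L : ℝ) ^ k) ^ 2) / (Fintype.card n : ℝ) - 28 * d * a' * ((L : ℝ) ^ k) ^ 2) :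
    X = (fun _ _ => 0) ∧ vary U X 1 = U := by
  have h0 := eq_zero_of_energyNormW_sq_eq_zero hL hM U hXP
    (energyNormW_sq_eq_zero_of_two_slops hL hM hU hX hXP hα hXα hm ha' hrad hleft hright hline)
  refine ⟨h0, ?_⟩
  rw [h0]
  exact vary_zero_dir U 1

/-! ## §2 Two critical configurations, one represented over the other: slice-generic weighted form -/

/-- **AT MOST ONE CRITICAL ORBIT MODULO REP — WEIGHTED CURRENCY, ANY POINCARÉ SLICE.**  `L, M ≥ 1`; `U` unitary with `SmallField U a` (`a ≥ 0`), critical on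
`T` (`dAction U Y = 0` for `Y ∈ T`) where `SlicePoincare L k U T C (periodBox M)`, `C ≥ 0`; `X` skew `M`-periodic with `‖X‖_∞ ≤ α`, `SmallField (Ue^X) a`;
BASE split `X = X_T + X_N`, `X_T ∈ T`, `X_N` skew, `‖X_N‖_w ≤ ν‖X‖_w`, `a·Σ‖curl_U X_N‖ ≤ κ₁‖X‖_w²`; the FAR configuration `Ue^X` critical on `T′`, FAR split
`X = X′_T + X′_N`, `X′_T ∈ T′`, `X′_N` skew, `a·Σ‖curl_{Ue^X} X′_N‖ ≤ κ′₁‖X‖_w²` (all windows `plaqsOf (periodBox M)`, all weights at `U`); STRICT line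
`κ₁ + κ′₁ < ((((1∕2 − ν²)∕(2(1+C)) − ν²)∕2 − 576d(e^α−1)²(L^k)²)∕card n − 28d(a+7α²)(L^k)²)` ⟹ `X = 0 ∧ Ue^X = U`. [folklore] -/
theorem vary_eq_self_of_two_critical_weighted [Nonempty n] {L k M : ℕ} (hL : 1 ≤ L) (hM : 1 ≤ M) {U : Site d → Fin d → (Matrix n n ℂ)ˣ}
    (hU : IsUnitaryCfg U) {a : ℝ} (ha : 0 ≤ a) (hUa : SmallField U a) {T T' : Set (Site d → Fin d → Matrix n n ℂ)} {C : ℝ} (hC : 0 ≤ C)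
    (hP : SlicePoincare L k U T C (periodBox (d := d) M)) (hcrit : ∀ Y ∈ T, dAction U Y (plaqsOf (periodBox (d := d) M)) = 0)
    {X XT XN XT' XN' : Site d → Fin d → Matrix n n ℂ} {α ν κ₁ κ₁' : ℝ} (hXs : IsSkewDir X) (hXP : IsPeriodicDir X M)
    (hα : 0 ≤ α) (hXα : ∀ x μ, ‖X x μ‖ ≤ α) (h1 : SmallField (vary U X 1) a)
    (hsplit : X = XT + XN) (hXT : XT ∈ T) (hXNs : IsSkewDir XN)
    (hNw : energyNormW L k U XN (periodBox (d := d) M) ≤ ν * energyNormW L k U X (periodBox (d := d) M))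
    (hN1 : a * (∑ p ∈ plaqsOf (periodBox (d := d) M), ‖curl U XN p‖) ≤ κ₁ * energyNormW L k U X (periodBox (d := d) M) ^ 2)
    (hcrit' : ∀ Y ∈ T', dAction (vary U X 1) Y (plaqsOf (periodBox (d := d) M)) = 0)
    (hsplit' : X = XT' + XN') (hXT' : XT' ∈ T') (hXN's : IsSkewDir XN')
    (hN1' : a * (∑ p ∈ plaqsOf (periodBox (d := d) M), ‖curl (vary U X 1) XN' p‖) ≤ κ₁' * energyNormW L k U X (periodBox (d := d) M) ^ 2)
    (hline : κ₁ + κ₁' < ((((1 / 2 - ν ^ 2) / (2 * (1 + C)) - ν ^ 2) / 2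
        - 576 * d * (Real.exp α - 1) ^ 2 * ((L : ℝ) ^ k) ^ 2) / (Fintype.card n : ℝ) - 28 * d * (a + 7 * α ^ 2) * ((L : ℝ) ^ k) ^ 2)) :
    X = (fun _ _ => 0) ∧ vary U X 1 = U := by
  set E := energyNormW L k U X (periodBox (d := d) M) ^ 2 with hEdef
  -- the weighted Poincaré letter at the base from the slice and the relative size of the normal part
  have hNw2 : energyNormW L k U XN (periodBox (d := d) M) ^ 2 ≤ ν ^ 2 * E := by
    have h0 := energyNormW_nonneg L k U XN (periodBox (d := d) M)
    calc energyNormW L k U XN (periodBox (d := d) M) ^ 2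
        ≤ (ν * energyNormW L k U X (periodBox (d := d) M)) ^ 2 := pow_le_pow_left₀ h0 hNw 2
      _ = ν ^ 2 * E := by rw [hEdef]; ring
  have hm := curlSq_ge_weighted hC hP hsplit hXT hNw2
  -- the radius along the segment
  have hrad : ∀ t ∈ Icc (0 : ℝ) 1, SmallField (vary U X t) (a + 7 * α ^ 2) := fun t ht =>
    smallField_vary_segment_class hU hXs hUa h1 hXα ht
  have ha' : 0 ≤ a + 7 * α ^ 2 := add_nonneg ha (mul_nonneg (by norm_num) (sq_nonneg α))
  -- base slop from criticality on `X_T` and the ℓ¹-curl letter of `X_N`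
  have hleft : -(κ₁ * E) ≤ dAction U X (plaqsOf (periodBox (d := d) M)) := by
    have h := dAction_ge_of_tangent_critical hU hUa hsplit hXNs (plaqsOf (periodBox (d := d) M)) (hcrit XT hXT)
    linarith
  -- far slop from criticality of `Ue^X` on `X′_T` and the ℓ¹-curl letter of `X′_N`
  have hU1 : IsUnitaryCfg (vary U X 1) := AveragingDeficitPlaqDeriv.vary_isUnitaryCfg hU hXs 1
  have hright : dAction (vary U X 1) X (plaqsOf (periodBox (d := d) M)) ≤ κ₁' * E := by
    have h := abs_dAction_le_of_tangent_critical hU1 ha h1 hsplit' hXN's (plaqsOf (periodBox (d := d) M)) (hcrit' XT' hXT')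
      (CN := 1) (D := ∑ p ∈ plaqsOf (periodBox (d := d) M), ‖curl (vary U X 1) XN' p‖) (by rw [one_mul])
    have e : a * 1 * (∑ p ∈ plaqsOf (periodBox (d := d) M), ‖curl (vary U X 1) XN' p‖)
        = a * (∑ p ∈ plaqsOf (periodBox (d := d) M), ‖curl (vary U X 1) XN' p‖) := by ring
    rw [e] at h
    linarith [le_abs_self (dAction (vary U X 1) X (plaqsOf (periodBox (d := d) M)))]
  exact vary_eq_self_of_two_slops_weighted hL hM hU hXs hXP hα hXα hm ha' hrad hleft hright hline

/-! ## §3 Class level: two TANGENT-CRITICAL admissible configurations, the representative in row NE3's slice `T_♮(U♯)` -/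

/-- **AT MOST ONE TANGENT-CRITICAL ORBIT MODULO REP_w ON THE CLASS** (F26 §2's twin for a CRITICAL competitor).  `U♯ ∈ admissible (sfClass d L N ε) L (k+1) V`
(`L, N ≥ 1`, `ε ≥ 0`) TANGENT-CRITICAL, (P♮)_W on the class with constant `CP > 0`; a skew `(N·L^{k+1})`-periodic `X` (`‖X‖_∞ ≤ α`) with
`SmallField (U♯e^X) (ε(L^{k+1})^{−2})`, BASE split `X = X_T + X_N` (`X_T ∈ T_♮(U♯)`, F9's weighted letters `ν`, `κ₁`); the far configuration `U♯e^X`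
TANGENT-CRITICAL and a FAR split `X = X′_T + X′_N` with `X′_T` skew periodic `U♯e^X`-TANGENT and the ℓ¹-curl letter `κ′₁` of `X′_N`; STRICT line with
`κ₁ + κ′₁` ⟹ `X = 0 ∧ U♯e^X = U♯`. [folklore] -/
theorem vary_eq_self_of_tanCritical_pair_repW [Nonempty n] {L N k : ℕ} [NeZero L] [NeZero N] (hL : 1 ≤ L) (hN : 1 ≤ N) {ε CP : ℝ}
    (hε : 0 ≤ ε) (hCP : 0 < CP)
    (hP : ∀ (j : ℕ) (W : Site d → Fin d → (Matrix n n ℂ)ˣ), W ∈ sfClass d L N ε (j + 1) →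
      SlicePoincare L (j + 1) W (frameFreeBlockLandauW L N (j + 1) W) CP (periodBox (d := d) (N * L ^ (j + 1))))
    {V Us : Site d → Fin d → (Matrix n n ℂ)ˣ} (hmem : Us ∈ admissible (sfClass d L N ε) L (k + 1) V)
    (hcritT : ∀ φ : Site d → Fin d → Matrix n n ℂ, IsSkewDir φ → IsPeriodicDir φ ((N * L ^ (k + 1) : ℕ) : ℤ) → TangentIter L k Us φ →
      dAction Us φ (perWin d (N * L ^ (k + 1))) = 0)
    {X XT XN XT' XN' : Site d → Fin d → Matrix n n ℂ} {α ν κ₁ κ₁' : ℝ} (hXs : IsSkewDir X) (hXP : IsPeriodicDir X ((N * L ^ (k + 1) : ℕ) : ℤ))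
    (hα : 0 ≤ α) (hXα : ∀ x μ, ‖X x μ‖ ≤ α) (h1 : SmallField (vary Us X 1) (ε / ((L : ℝ) ^ (k + 1)) ^ 2)) (hsplit : X = XT + XN)
    (hXT : XT ∈ frameFreeBlockLandauW (d := d) (n := n) L N (k + 1) Us) (hXNs : IsSkewDir XN)
    (hNw : energyNormW L (k + 1) Us XN (periodBox (d := d) (N * L ^ (k + 1)))
      ≤ ν * energyNormW L (k + 1) Us X (periodBox (d := d) (N * L ^ (k + 1))))
    (hN1 : ε / ((L : ℝ) ^ (k + 1)) ^ 2 * (∑ p ∈ perWin d (N * L ^ (k + 1)), ‖curl Us XN p‖)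
      ≤ κ₁ * energyNormW L (k + 1) Us X (periodBox (d := d) (N * L ^ (k + 1))) ^ 2)
    (hcritT' : ∀ φ : Site d → Fin d → Matrix n n ℂ, IsSkewDir φ → IsPeriodicDir φ ((N * L ^ (k + 1) : ℕ) : ℤ) →
      TangentIter L k (vary Us X 1) φ → dAction (vary Us X 1) φ (perWin d (N * L ^ (k + 1))) = 0)
    (hsplit' : X = XT' + XN') (hXT's : IsSkewDir XT') (hXT'P : IsPeriodicDir XT' ((N * L ^ (k + 1) : ℕ) : ℤ))
    (hXT'T : TangentIter L k (vary Us X 1) XT') (hXN's : IsSkewDir XN')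
    (hN1' : ε / ((L : ℝ) ^ (k + 1)) ^ 2 * (∑ p ∈ perWin d (N * L ^ (k + 1)), ‖curl (vary Us X 1) XN' p‖)
      ≤ κ₁' * energyNormW L (k + 1) Us X (periodBox (d := d) (N * L ^ (k + 1))) ^ 2)
    (hline : κ₁ + κ₁' < ((((1 / 2 - ν ^ 2) / (2 * (1 + CP)) - ν ^ 2) / 2
        - 576 * d * (Real.exp α - 1) ^ 2 * ((L : ℝ) ^ (k + 1)) ^ 2) / (Fintype.card n : ℝ)
        - 28 * d * (ε / ((L : ℝ) ^ (k + 1)) ^ 2 + 7 * α ^ 2) * ((L : ℝ) ^ (k + 1)) ^ 2)) :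
    X = (fun _ _ => 0) ∧ vary Us X 1 = Us := by
  have hN0 : 0 < N := hN
  have hL0 : 0 < L := hL
  have hM : 1 ≤ N * L ^ (k + 1) := Nat.mul_pos hN0 (Nat.pow_pos hL0)
  have e : perWin d (N * L ^ (k + 1)) = plaqsOf (periodBox (d := d) (N * L ^ (k + 1))) := rfl
  have ha : 0 ≤ ε / ((L : ℝ) ^ (k + 1)) ^ 2 := by positivity
  have hUs : IsUnitaryCfg Us := hmem.1.1
  have hUsa : SmallField Us (ε / ((L : ℝ) ^ (k + 1)) ^ 2) := hmem.1.2.2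
  -- criticality at the base on the tangent part `X_T ∈ T_♮(U♯) ⊆ T(U♯)`, packaged as criticality on the slice
  have hcrit : ∀ Y ∈ frameFreeBlockLandauW (d := d) (n := n) L N (k + 1) Us,
      dAction Us Y (plaqsOf (periodBox (d := d) (N * L ^ (k + 1)))) = 0 := by
    intro Y hY
    obtain ⟨hYs, hYP, hYT, -, -⟩ := hY
    have hYP' : IsPeriodicDir Y ((N * L ^ (k + 1) : ℕ) : ℤ) := by rw [← tower_eq L N (k + 1)]; exact hYP
    have hYT' : TangentIter L k Us Y := by simpa using hYT
    rw [← e]; exact hcritT Y hYs hYP' hYT'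
  -- criticality at the far end on the singleton slice `{X′_T}`
  have hcrit' : ∀ Y ∈ ({XT'} : Set (Site d → Fin d → Matrix n n ℂ)),
      dAction (vary Us X 1) Y (plaqsOf (periodBox (d := d) (N * L ^ (k + 1)))) = 0 := by
    intro Y hY
    rw [Set.mem_singleton_iff] at hY
    rw [hY, ← e]; exact hcritT' XT' hXT's hXT'P hXT'T
  rw [e] at hN1 hN1'
  exact vary_eq_self_of_two_critical_weighted (k := k + 1) hL hM hUs ha hUsa hCP.le (hP k Us hmem.1) hcrit hXs hXP hα hXα h1 hsplit hXT hXNs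
    hNw hN1 hcrit' hsplit' (Set.mem_singleton XT') hXN's hN1' hline

/-! ## §4 With the gauge identity: the second critical configuration IS a gauge transform of the first -/

/-- **TWO TANGENT-CRITICAL CONFIGURATIONS ON ONE FIBRE, ONE REPRESENTED OVER THE OTHER, ARE GAUGE EQUIVALENT**: under the hypotheses of
`vary_eq_self_of_tanCritical_pair_repW` and the gauge identity `U′^u = U♯e^X`, `U′^u = U♯`. [folklore] -/
theorem gaugeAct_eq_of_tanCritical_pair [Nonempty n] {L N k : ℕ} [NeZero L] [NeZero N] (hL : 1 ≤ L) (hN : 1 ≤ N) {ε CP : ℝ}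
    (hε : 0 ≤ ε) (hCP : 0 < CP)
    (hP : ∀ (j : ℕ) (W : Site d → Fin d → (Matrix n n ℂ)ˣ), W ∈ sfClass d L N ε (j + 1) →
      SlicePoincare L (j + 1) W (frameFreeBlockLandauW L N (j + 1) W) CP (periodBox (d := d) (N * L ^ (j + 1))))
    {V Us U' : Site d → Fin d → (Matrix n n ℂ)ˣ} (hmem : Us ∈ admissible (sfClass d L N ε) L (k + 1) V)
    (hcritT : ∀ φ : Site d → Fin d → Matrix n n ℂ, IsSkewDir φ → IsPeriodicDir φ ((N * L ^ (k + 1) : ℕ) : ℤ) → TangentIter L k Us φ →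
      dAction Us φ (perWin d (N * L ^ (k + 1))) = 0)
    {u : Site d → (Matrix n n ℂ)ˣ} (hu : IsUnitarySite u)
    {X XT XN XT' XN' : Site d → Fin d → Matrix n n ℂ} {α ν κ₁ κ₁' : ℝ} (hXs : IsSkewDir X) (hXP : IsPeriodicDir X ((N * L ^ (k + 1) : ℕ) : ℤ))
    (hα : 0 ≤ α) (hXα : ∀ x μ, ‖X x μ‖ ≤ α) (hgauge : gaugeAct u U' = vary Us X 1) (hU' : U' ∈ admissible (sfClass d L N ε) L (k + 1) V)
    (hsplit : X = XT + XN) (hXT : XT ∈ frameFreeBlockLandauW (d := d) (n := n) L N (k + 1) Us) (hXNs : IsSkewDir XN)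
    (hNw : energyNormW L (k + 1) Us XN (periodBox (d := d) (N * L ^ (k + 1)))
      ≤ ν * energyNormW L (k + 1) Us X (periodBox (d := d) (N * L ^ (k + 1))))
    (hN1 : ε / ((L : ℝ) ^ (k + 1)) ^ 2 * (∑ p ∈ perWin d (N * L ^ (k + 1)), ‖curl Us XN p‖)
      ≤ κ₁ * energyNormW L (k + 1) Us X (periodBox (d := d) (N * L ^ (k + 1))) ^ 2)
    (hcritT' : ∀ φ : Site d → Fin d → Matrix n n ℂ, IsSkewDir φ → IsPeriodicDir φ ((N * L ^ (k + 1) : ℕ) : ℤ) →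
      TangentIter L k (vary Us X 1) φ → dAction (vary Us X 1) φ (perWin d (N * L ^ (k + 1))) = 0)
    (hsplit' : X = XT' + XN') (hXT's : IsSkewDir XT') (hXT'P : IsPeriodicDir XT' ((N * L ^ (k + 1) : ℕ) : ℤ))
    (hXT'T : TangentIter L k (vary Us X 1) XT') (hXN's : IsSkewDir XN')
    (hN1' : ε / ((L : ℝ) ^ (k + 1)) ^ 2 * (∑ p ∈ perWin d (N * L ^ (k + 1)), ‖curl (vary Us X 1) XN' p‖)
      ≤ κ₁' * energyNormW L (k + 1) Us X (periodBox (d := d) (N * L ^ (k + 1))) ^ 2)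
    (hline : κ₁ + κ₁' < ((((1 / 2 - ν ^ 2) / (2 * (1 + CP)) - ν ^ 2) / 2
        - 576 * d * (Real.exp α - 1) ^ 2 * ((L : ℝ) ^ (k + 1)) ^ 2) / (Fintype.card n : ℝ)
        - 28 * d * (ε / ((L : ℝ) ^ (k + 1)) ^ 2 + 7 * α ^ 2) * ((L : ℝ) ^ (k + 1)) ^ 2)) :
    gaugeAct u U' = Us := by
  have h1 : SmallField (vary Us X 1) (ε / ((L : ℝ) ^ (k + 1)) ^ 2) := by
    rw [← hgauge]
    exact smallField_gaugeAct hu hU'.1.2.2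
  obtain ⟨-, hself⟩ := vary_eq_self_of_tanCritical_pair_repW hL hN hε hCP hP hmem hcritT hXs hXP hα hXα h1 hsplit hXT hXNs hNw hN1 hcritT'
    hsplit' hXT's hXT'P hXT'T hXN's hN1' hline
  rw [hgauge, hself]

/-- **HENCE THE SECOND TANGENT-CRITICAL CONFIGURATION IS AS SMALL AS THE FIRST** («the curved (APE) at a TANGENT-CRITICAL reference», the END shape of road (B),
with NO Green's-function row): under the hypotheses of `gaugeAct_eq_of_tanCritical_pair`, `SmallField U♯ r ⟹ SmallField U′ r`. [folklore] -/
theorem smallField_of_tanCritical_pair_repW_gauge [Nonempty n] {L N k : ℕ} [NeZero L] [NeZero N] (hL : 1 ≤ L) (hN : 1 ≤ N) {ε CP : ℝ}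
    (hε : 0 ≤ ε) (hCP : 0 < CP)
    (hP : ∀ (j : ℕ) (W : Site d → Fin d → (Matrix n n ℂ)ˣ), W ∈ sfClass d L N ε (j + 1) →
      SlicePoincare L (j + 1) W (frameFreeBlockLandauW L N (j + 1) W) CP (periodBox (d := d) (N * L ^ (j + 1))))
    {V Us U' : Site d → Fin d → (Matrix n n ℂ)ˣ} (hmem : Us ∈ admissible (sfClass d L N ε) L (k + 1) V)
    (hcritT : ∀ φ : Site d → Fin d → Matrix n n ℂ, IsSkewDir φ → IsPeriodicDir φ ((N * L ^ (k + 1) : ℕ) : ℤ) → TangentIter L k Us φ →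
      dAction Us φ (perWin d (N * L ^ (k + 1))) = 0)
    {u : Site d → (Matrix n n ℂ)ˣ} (hu : IsUnitarySite u)
    {X XT XN XT' XN' : Site d → Fin d → Matrix n n ℂ} {α ν κ₁ κ₁' : ℝ} (hXs : IsSkewDir X) (hXP : IsPeriodicDir X ((N * L ^ (k + 1) : ℕ) : ℤ))
    (hα : 0 ≤ α) (hXα : ∀ x μ, ‖X x μ‖ ≤ α) (hgauge : gaugeAct u U' = vary Us X 1) (hU' : U' ∈ admissible (sfClass d L N ε) L (k + 1) V)
    (hsplit : X = XT + XN) (hXT : XT ∈ frameFreeBlockLandauW (d := d) (n := n) L N (k + 1) Us) (hXNs : IsSkewDir XN)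
    (hNw : energyNormW L (k + 1) Us XN (periodBox (d := d) (N * L ^ (k + 1)))
      ≤ ν * energyNormW L (k + 1) Us X (periodBox (d := d) (N * L ^ (k + 1))))
    (hN1 : ε / ((L : ℝ) ^ (k + 1)) ^ 2 * (∑ p ∈ perWin d (N * L ^ (k + 1)), ‖curl Us XN p‖)
      ≤ κ₁ * energyNormW L (k + 1) Us X (periodBox (d := d) (N * L ^ (k + 1))) ^ 2)
    (hcritT' : ∀ φ : Site d → Fin d → Matrix n n ℂ, IsSkewDir φ → IsPeriodicDir φ ((N * L ^ (k + 1) : ℕ) : ℤ) →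
      TangentIter L k (vary Us X 1) φ → dAction (vary Us X 1) φ (perWin d (N * L ^ (k + 1))) = 0)
    (hsplit' : X = XT' + XN') (hXT's : IsSkewDir XT') (hXT'P : IsPeriodicDir XT' ((N * L ^ (k + 1) : ℕ) : ℤ))
    (hXT'T : TangentIter L k (vary Us X 1) XT') (hXN's : IsSkewDir XN')
    (hN1' : ε / ((L : ℝ) ^ (k + 1)) ^ 2 * (∑ p ∈ perWin d (N * L ^ (k + 1)), ‖curl (vary Us X 1) XN' p‖)
      ≤ κ₁' * energyNormW L (k + 1) Us X (periodBox (d := d) (N * L ^ (k + 1))) ^ 2)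
    (hline : κ₁ + κ₁' < ((((1 / 2 - ν ^ 2) / (2 * (1 + CP)) - ν ^ 2) / 2
        - 576 * d * (Real.exp α - 1) ^ 2 * ((L : ℝ) ^ (k + 1)) ^ 2) / (Fintype.card n : ℝ)
        - 28 * d * (ε / ((L : ℝ) ^ (k + 1)) ^ 2 + 7 * α ^ 2) * ((L : ℝ) ^ (k + 1)) ^ 2))
    {r : ℝ} (hUsr : SmallField Us r) : SmallField U' r :=
  smallField_of_gaugeAct_eq hu (gaugeAct_eq_of_tanCritical_pair hL hN hε hCP hP hmem hcritT hu hXs hXP hα hXα hgauge hU' hsplit hXT hXNs hNw hN1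
    hcritT' hsplit' hXT's hXT'P hXT'T hXN's hN1' hline) hUsr

end

end Summit.QuantumFields.BalabanUV.T4Continuum.NE7ConvOneStepWeightedCriticalUnique
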